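import Literature.NumberTheory.EllipticCurves.KubertTate289CubicSupportBp
import HarnessLib

/-!
# `E_{28/9}` over its cubic `2`-division field: `Ш(X/K)[φ] = 0` by the complete `2`-isogeny descent, `φ`-side

Topic `NumberTheory/EllipticCurves`. Third file on `X = E_{A,B} ≅ E_K` over `K = ℚ(γ)` (`γ³ - γ² + 27γ + 36 = 0`,
`[K : ℚ] = 3`; `KubertTate289CubicModel`, `KubertTate289CubicLocalOdd`). We prove

* `sha_inf_range_twoIsogenyTorsorHom_X_eq_bot` — **`Ш(X/K) ∩ im Ξ_X = ⊥`**, i.e. `Ш(X/K)[φ] = 0`: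
  by the tree's criterion `sha_inf_range_twoIsogenyTorsorHom_eq_bot_of_local'` (Silverman *AEC* X.4.9 over `K`) it
  suffices that every `q ∈ Kˣ` whose class lies in `K(S, 2)`, `S = supp (B') = {𝔭₂, 𝔭₃c, 𝔮₇, 𝔮₂₀₆₉}`
  (`support_Bp`, file `KubertTate289CubicSupportBp`), and which satisfies the local conditions `[q]_v ∈ α(X'(K_v))` everywhere, has `[q] ∈ α(X'(K))`.
  By the tree's `K(S, 2)`-enumeration (`CubicField14483.exists_rep_of_two_dvd_log_outside`),
  `q ≡ (-1)^s ε^i π₀^c g₃c^{e₁} q₇^{e₂} q₂₀₆₉^{e₃}` modulo squares (`64` classes); the quadratic-residue conditions at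
  `𝔭₃a, 𝔭₃b, 𝔭₇, 𝔭₂₀₆₉` (`sq_residue_p3a/p3b/p7/p2069`) are four independent `𝔽₂`-linear conditions on the
  exponents (`kill_phi_side`, decided), leaving exactly `{1, q₇q₂₀₆₉ = y, -ε, -ε y}` — the classes of
  `O, T' + Q', Q', T'` on `X'(K)` (`KubertTate289CubicModel` §3).

So `#S^{(φ)}(X/K) = 4 = #X'(K)/φ(X(K))` and `Ш(X/K)[φ] = 0`; the `φ̂`-side (with the dyadic place `𝔭₂`) and the
conclusion `Ш(E_K)[2] = 0 ⇒ t₂(E_{28/9}) = 0` follow in sequel files. Theorems only; no named facts.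

## References
* [SilvermanAEC2009] J. H. Silverman, *The Arithmetic of Elliptic Curves*, 2nd ed. (2009), Thm. X.4.2, Prop. X.4.9.
* [Marcus2018] D. A. Marcus, *Number Fields*, 2nd ed. (2018), Ch. 3 Thm. 22, 27; Ch. 5.
-/

noncomputable section

namespace Literature.NumberTheory.EllipticCurves

namespace KubertTate289Cubic

/-! ## §0 Finite facts (decided before any local instance or classical `Decidable` is in scope) -/

/-- Residues of the generators `ε, π₀, g₃c, q₇, q₂₀₆₉` at `𝔭₃a` (`γ, δ ↦ 1, 0`), `𝔭₃b` (`0, 1`), `𝔭₇` (`1, 6`),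
`𝔭₂₀₆₉` (`1278, 1930`). [cite: Marcus2018, Ch. 3, Thm. 27] -/
private theorem gen_residues :
    ((-15 : ZMod 3) - 1 + 2 * 0 = 2 ∧ ((6 : ℤ) : ZMod 3) + ((1 : ℤ) : ZMod 3) * 1 + ((-1 : ℤ) : ZMod 3) * 0 = 1 ∧
      ((2 : ℤ) : ZMod 3) + ((-4 : ℤ) : ZMod 3) * 1 + ((-1 : ℤ) : ZMod 3) * 0 = 1 ∧
      ((-1 : ℤ) : ZMod 3) + ((-1 : ℤ) : ZMod 3) * 1 + ((0 : ℤ) : ZMod 3) * 0 = 1 ∧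
      ((-234 : ℤ) : ZMod 3) + ((40 : ℤ) : ZMod 3) * 1 + ((41 : ℤ) : ZMod 3) * 0 = 1) ∧
    ((-15 : ZMod 3) - 0 + 2 * 1 = 2 ∧ ((6 : ℤ) : ZMod 3) + ((1 : ℤ) : ZMod 3) * 0 + ((-1 : ℤ) : ZMod 3) * 1 = 2 ∧
      ((2 : ℤ) : ZMod 3) + ((-4 : ℤ) : ZMod 3) * 0 + ((-1 : ℤ) : ZMod 3) * 1 = 1 ∧
      ((-1 : ℤ) : ZMod 3) + ((-1 : ℤ) : ZMod 3) * 0 + ((0 : ℤ) : ZMod 3) * 1 = 2 ∧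
      ((-234 : ℤ) : ZMod 3) + ((40 : ℤ) : ZMod 3) * 0 + ((41 : ℤ) : ZMod 3) * 1 = 2) ∧
    ((-15 : ZMod 7) - 1 + 2 * 6 = 3 ∧ ((6 : ℤ) : ZMod 7) + ((1 : ℤ) : ZMod 7) * 1 + ((-1 : ℤ) : ZMod 7) * 6 = 1 ∧
      ((2 : ℤ) : ZMod 7) + ((-4 : ℤ) : ZMod 7) * 1 + ((-1 : ℤ) : ZMod 7) * 6 = 6 ∧
      ((-1 : ℤ) : ZMod 7) + ((-1 : ℤ) : ZMod 7) * 1 + ((0 : ℤ) : ZMod 7) * 6 = 5 ∧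
      ((-234 : ℤ) : ZMod 7) + ((40 : ℤ) : ZMod 7) * 1 + ((41 : ℤ) : ZMod 7) * 6 = 3) ∧
    ((-15 : ZMod 2069) - 1278 + 2 * 1930 = 498 ∧
      ((6 : ℤ) : ZMod 2069) + ((1 : ℤ) : ZMod 2069) * 1278 + ((-1 : ℤ) : ZMod 2069) * 1930 = 1423 ∧
      ((2 : ℤ) : ZMod 2069) + ((-4 : ℤ) : ZMod 2069) * 1278 + ((-1 : ℤ) : ZMod 2069) * 1930 = 1236 ∧
      ((-1 : ℤ) : ZMod 2069) + ((-1 : ℤ) : ZMod 2069) * 1278 + ((0 : ℤ) : ZMod 2069) * 1930 = 790 ∧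
      ((-234 : ℤ) : ZMod 2069) + ((40 : ℤ) : ZMod 2069) * 1278 + ((41 : ℤ) : ZMod 2069) * 1930 = 1738) := by
  refine ⟨by decide, by decide, by decide, by decide⟩

/-- The products of generator residues never vanish. [cite: Marcus2018, Ch. 3, Thm. 27] -/
private theorem gen_products_ne_zero : ∀ s i c e₁ e₂ e₃ : Fin 2,
    (-1 : ZMod 3) ^ (s : ℕ) * 2 ^ (i : ℕ) * 1 ^ (c : ℕ) * (1 ^ (e₁ : ℕ) * 1 ^ (e₂ : ℕ) * 1 ^ (e₃ : ℕ)) ≠ 0 ∧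
    (-1 : ZMod 3) ^ (s : ℕ) * 2 ^ (i : ℕ) * 2 ^ (c : ℕ) * (1 ^ (e₁ : ℕ) * 2 ^ (e₂ : ℕ) * 2 ^ (e₃ : ℕ)) ≠ 0 ∧
    (-1 : ZMod 7) ^ (s : ℕ) * 3 ^ (i : ℕ) * 1 ^ (c : ℕ) * (6 ^ (e₁ : ℕ) * 5 ^ (e₂ : ℕ) * 3 ^ (e₃ : ℕ)) ≠ 0 ∧
    (-1 : ZMod 2069) ^ (s : ℕ) * 498 ^ (i : ℕ) * 1423 ^ (c : ℕ) *
      (1236 ^ (e₁ : ℕ) * 790 ^ (e₂ : ℕ) * 1738 ^ (e₃ : ℕ)) ≠ 0 := by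
  decide

/-- **The `𝔽₂`-linear algebra of the `φ`-side**: the residue conditions at `𝔭₃a, 𝔭₃b, 𝔭₇` (non-zero squares) together
with `e₁ = 0` (from `𝔭₂₀₆₉`) leave exactly the exponent patterns of `1, q₇q₂₀₆₉, -ε, -ε q₇ q₂₀₆₉`.
[cite: SilvermanAEC2009, Prop. X.4.9] -/
private theorem kill_phi_side : ∀ s i c e₁ e₂ e₃ : Fin 2,
    (∃ r : ZMod 3, r ≠ 0 ∧
      (-1 : ZMod 3) ^ (s : ℕ) * 2 ^ (i : ℕ) * 1 ^ (c : ℕ) * (1 ^ (e₁ : ℕ) * 1 ^ (e₂ : ℕ) * 1 ^ (e₃ : ℕ)) = r ^ 2) →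
    (∃ r : ZMod 3, r ≠ 0 ∧
      (-1 : ZMod 3) ^ (s : ℕ) * 2 ^ (i : ℕ) * 2 ^ (c : ℕ) * (1 ^ (e₁ : ℕ) * 2 ^ (e₂ : ℕ) * 2 ^ (e₃ : ℕ)) = r ^ 2) →
    (∃ r : ZMod 7, r ≠ 0 ∧
      (-1 : ZMod 7) ^ (s : ℕ) * 3 ^ (i : ℕ) * 1 ^ (c : ℕ) * (6 ^ (e₁ : ℕ) * 5 ^ (e₂ : ℕ) * 3 ^ (e₃ : ℕ)) = r ^ 2) →
    (e₁ : ℕ) = 0 → (c : ℕ) = 0 ∧ (s : ℕ) = i ∧ (e₂ : ℕ) = e₃ := by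
  intro s i c e₁ e₂ e₃
  fin_cases s <;> fin_cases i <;> fin_cases c <;> fin_cases e₁ <;> fin_cases e₂ <;> fin_cases e₃ <;> decide

/-- `1236` is not a square modulo `2069` (while `-1, 498, 1423, 790, 1738` are: `2069 ≡ 1 mod 4`, `415² ≡ 498`, …).
[cite: Marcus2018, Ch. 3, Thm. 27] -/
private theorem sq_data_2069 : (-1 : ZMod 2069) = 164 ^ 2 ∧ (498 : ZMod 2069) = 415 ^ 2 ∧
    (1423 : ZMod 2069) = 518 ^ 2 ∧ (790 : ZMod 2069) = 666 ^ 2 ∧ (1738 : ZMod 2069) = 414 ^ 2 ∧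
    ¬ IsSquare (1236 : ZMod 2069) := by
  refine ⟨by decide, by decide, by decide, by decide, by decide, by decide +kernel⟩

/-! ## §1 Notation -/

open scoped _root_.Classical _root_.NumberField
open _root_.Polynomial _root_.Module _root_.NumberField _root_.Ideal _root_.IsDedekindDomain
open _root_.WeierstrassCurve _root_.WeierstrassCurve.Affine
open _root_.Literature.NumberTheory.NumberFields _root_.Literature.NumberTheory.NumberFields.MonicCubic
open _root_.Literature.NumberTheory.NumberFields.CubicField14483

variable {K : Type*} [Field K] [NumberField K] {γ : K}

/-! ## §2 Bookkeeping: sublists of a three-element list, square classes of `d w²` -/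

/-- A sublist of `[a, b, c]` has product `a^{e₁} b^{e₂} c^{e₃}` with `eᵢ ∈ {0, 1}`. [folklore] -/
private theorem prod_eq_pow_of_sublist_three {M : Type*} [CommMonoid M] (a b c : M) {l : List M}
    (h : l.Sublist [a, b, c]) :
    ∃ e₁ e₂ e₃ : ℕ, e₁ ≤ 1 ∧ e₂ ≤ 1 ∧ e₃ ≤ 1 ∧ l.prod = a ^ e₁ * b ^ e₂ * c ^ e₃ := by
  rcases List.sublist_cons_iff.mp h with h1 | ⟨l₁, rfl, h1⟩
  · rcases List.sublist_cons_iff.mp h1 with h2 | ⟨l₂, rfl, h2⟩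
    · rcases List.sublist_cons_iff.mp h2 with h3 | ⟨l₃, rfl, h3⟩
      · rw [List.sublist_nil] at h3; subst h3
        exact ⟨0, 0, 0, by omega, by omega, by omega, by simp⟩
      · rw [List.sublist_nil] at h3; subst h3
        exact ⟨0, 0, 1, by omega, by omega, by omega, by simp⟩
    · rcases List.sublist_cons_iff.mp h2 with h3 | ⟨l₃, rfl, h3⟩
      · rw [List.sublist_nil] at h3; subst h3
        exact ⟨0, 1, 0, by omega, by omega, by omega, by simp⟩
      · rw [List.sublist_nil] at h3; subst h3
        exact ⟨0, 1, 1, by omega, by omega, by omega, by simp⟩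
  · rcases List.sublist_cons_iff.mp h1 with h2 | ⟨l₂, rfl, h2⟩
    · rcases List.sublist_cons_iff.mp h2 with h3 | ⟨l₃, rfl, h3⟩
      · rw [List.sublist_nil] at h3; subst h3
        exact ⟨1, 0, 0, by omega, by omega, by omega, by simp⟩
      · rw [List.sublist_nil] at h3; subst h3
        exact ⟨1, 0, 1, by omega, by omega, by omega, by simp⟩
    · rcases List.sublist_cons_iff.mp h2 with h3 | ⟨l₃, rfl, h3⟩
      · rw [List.sublist_nil] at h3; subst h3
        exact ⟨1, 1, 0, by omega, by omega, by omega, by simp⟩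
      · rw [List.sublist_nil] at h3; subst h3
        exact ⟨1, 1, 1, by omega, by omega, by omega, by simp [mul_assoc]⟩

omit [NumberField K] in
/-- `[f(d w²)] = [f(d)]` along a ring homomorphism of fields (`w ≠ 0`, `d w² ≠ 0`). [cite: SilvermanTate2015, §3.5] -/
private theorem sqClass_map_mul_sq {F : Type*} [Field F] (f : K →+* F) {q d w : K} (hq : q ≠ 0) (h : q = d * w ^ 2) :
    sqClass (f q) = sqClass (f d) := by
  have hd : d ≠ 0 := by rintro rfl; exact hq (by rw [h, zero_mul])
  have hw : w ≠ 0 := by rintro rfl; exact hq (by rw [h]; ring)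
  rw [h, map_mul, map_pow, mul_comm]
  exact sqClass_sq_mul ((map_ne_zero f).mpr hw) ((map_ne_zero f).mpr hd)

/-! ## §3 `Ш(X/K) ∩ im Ξ_X = ⊥` -/

/-- **`Ш(X/K)[φ] = 0` for `X = E_{A,B} ≅ E_{28/9} ⊗ K` over the cubic field `K = ℚ(γ)`**: the `φ`-Selmer group
`Ξ⁻¹(Ш(X/K)) ⊆ K(S, 2)` is cut down to `α(X'(K)) = {1, [y], [-ε], [-ε y]}` by the quadratic-residue conditions at
`𝔭₃a, 𝔭₃b, 𝔭₇, 𝔭₂₀₆₉`, so `Ш(X/K) ∩ im Ξ_X = ⊥` (Silverman *AEC* X.4.9 assembled over `K` by the tree's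
`sha_inf_range_twoIsogenyTorsorHom_eq_bot_of_local'`). [cite: SilvermanAEC2009, Prop. X.4.9] -/
theorem sha_inf_range_twoIsogenyTorsorHom_X_eq_bot (hγ : γ ^ 3 - γ ^ 2 + 27 * γ + 36 = 0) (h3 : finrank ℚ K = 3) :
    haveI := isElliptic_X hγ
    (⟨0, -73 * γ ^ 2 - 155 * γ - 1238, 0, (88849 * γ ^ 2 - 562957 * γ + 1141719) / 3, 0⟩ : WeierstrassCurve K).sha ⊓
      AddMonoidHom.range (G := Additive (SqUnits K))
        (⟨0, -73 * γ ^ 2 - 155 * γ - 1238, 0, (88849 * γ ^ 2 - 562957 * γ + 1141719) / 3, 0⟩ :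
          WeierstrassCurve K).twoIsogenyTorsorHom = ⊥ := by
  -- finite facts first
  have r7 : ((6 : ℤ) : ZMod 7) ^ 3 + ((-1 : ℤ) : ZMod 7) * ((6 : ℤ) : ZMod 7) ^ 2 + ((27 : ℤ) : ZMod 7) * (6 : ℤ) +
      ((36 : ℤ) : ZMod 7) = 0 := by decide
  have r7' : ((1 : ℤ) : ZMod 7) ^ 3 + ((-1 : ℤ) : ZMod 7) * ((1 : ℤ) : ZMod 7) ^ 2 + ((27 : ℤ) : ZMod 7) * (1 : ℤ) +
      ((36 : ℤ) : ZMod 7) = 0 := by decide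
  have r2069 : ((1583 : ℤ) : ZMod 2069) ^ 3 + ((-1 : ℤ) : ZMod 2069) * ((1583 : ℤ) : ZMod 2069) ^ 2 +
      ((27 : ℤ) : ZMod 2069) * (1583 : ℤ) + ((36 : ℤ) : ZMod 2069) = 0 := by decide
  have r2069' : ((1278 : ℤ) : ZMod 2069) ^ 3 + ((-1 : ℤ) : ZMod 2069) * ((1278 : ℤ) : ZMod 2069) ^ 2 +
      ((27 : ℤ) : ZMod 2069) * (1278 : ℤ) + ((36 : ℤ) : ZMod 2069) = 0 := by decide
  have e2069δ : (690 : ZMod 2069) * (1583 ^ 2 - 1583 + 18) = 278 := by decide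
  have e2069δ' : (690 : ZMod 2069) * (1278 ^ 2 - 1278 + 18) = 1930 := by decide
  have e7δ' : (5 : ZMod 7) * (1 ^ 2 - 1 + 18) = 6 := by decide
  have e3aγ : (1 : ZMod 3) - ((0 : ℤ) : ZMod 3) ^ 2 = 1 := by decide
  have e3bγ : (1 : ZMod 3) - ((1 : ℤ) : ZMod 3) ^ 2 = 0 := by decide
  have e3cδ : ((2 : ℤ) : ZMod 3) = 2 := by decide
  have e3cγ : (1 : ZMod 3) - ((2 : ℤ) : ZMod 3) ^ 2 = 0 := by decide
  have e76 : ((6 : ℤ) : ZMod 7) = 6 := by decide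
  have e91583 : ((1583 : ℤ) : ZMod 2069) = 1583 := by decide
  have e91278 : ((1278 : ℤ) : ZMod 2069) = 1278 := by decide
  obtain ⟨⟨eE3a, eP3a, eG3a, eQ3a, eR3a⟩, ⟨eE3b, eP3b, eG3b, eQ3b, eR3b⟩, ⟨eE7, eP7, eG7, eQ7, eR7⟩,
    ⟨eE9, eP9, eG9, eQ9, eR9⟩⟩ := gen_residues
  obtain ⟨sq1, sq2, sq3, sq5, sq6, nsq⟩ := sq_data_2069
  haveI : Fact (Nat.Prime 7) := ⟨by norm_num⟩
  haveI : Fact (Nat.Prime 2069) := ⟨by norm_num⟩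
  haveI := isElliptic_X hγ
  haveI hX' := isElliptic_X' hγ
  set X : WeierstrassCurve K :=
    ⟨0, -73 * γ ^ 2 - 155 * γ - 1238, 0, (88849 * γ ^ 2 - 562957 * γ + 1141719) / 3, 0⟩ with hX
  have hX'eq : X.twoIsogenyCodomain =
      ⟨0, 146 * γ ^ 2 + 310 * γ + 2476, 0, (-88849 * γ ^ 2 + 562957 * γ - 2988516) / 3, 0⟩ :=
    twoIsogenyCodomain_X hγ
  -- the residue maps and places
  obtain ⟨ψ₁, hψ₁⟩ := exists_psi_two hγ h3
  obtain ⟨φ₃a, hφ₃aδ, hφ₃aγ⟩ := exists_residueHom_three hγ h3 0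
  obtain ⟨φ₃b, hφ₃bδ, hφ₃bγ⟩ := exists_residueHom_three hγ h3 1
  obtain ⟨φ₃c, hφ₃cδ, hφ₃cγ⟩ := exists_residueHom_three hγ h3 2
  obtain ⟨φ₇, hφ₇γ, -⟩ := exists_residueHom_gamma hγ h3 (p := 7) (by norm_num) 6 r7
  obtain ⟨φ₇', hφ₇'γ, -⟩ := exists_residueHom_gamma hγ h3 (p := 7) (by norm_num) 1 r7'
  obtain ⟨φ₉, hφ₉γ, -⟩ := exists_residueHom_gamma hγ h3 (p := 2069) (by norm_num) 1583 r2069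
  obtain ⟨φ₉', hφ₉'γ, -⟩ := exists_residueHom_gamma hγ h3 (p := 2069) (by norm_num) 1278 r2069'
  replace hφ₃aδ : φ₃a (thetaInt (delta_root hγ)) = 0 := by rw [hφ₃aδ, Int.cast_zero]
  replace hφ₃aγ : φ₃a (thetaInt (aeval_eq hγ)) = 1 := by rw [hφ₃aγ]; exact e3aγ
  replace hφ₃bδ : φ₃b (thetaInt (delta_root hγ)) = 1 := by rw [hφ₃bδ, Int.cast_one]
  replace hφ₃bγ : φ₃b (thetaInt (aeval_eq hγ)) = 0 := by rw [hφ₃bγ]; exact e3bγ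
  replace hφ₃cδ : φ₃c (thetaInt (delta_root hγ)) = 2 := by rw [hφ₃cδ]; exact e3cδ
  replace hφ₃cγ : φ₃c (thetaInt (aeval_eq hγ)) = 0 := by rw [hφ₃cγ]; exact e3cγ
  replace hφ₇γ : φ₇ (thetaInt (aeval_eq hγ)) = 6 := by rw [hφ₇γ]; exact e76
  replace hφ₇'γ : φ₇' (thetaInt (aeval_eq hγ)) = 1 := by rw [hφ₇'γ, Int.cast_one]
  replace hφ₉γ : φ₉ (thetaInt (aeval_eq hγ)) = 1583 := by rw [hφ₉γ]; exact e91583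
  replace hφ₉'γ : φ₉' (thetaInt (aeval_eq hγ)) = 1278 := by rw [hφ₉'γ]; exact e91278
  have hφ₉δ : φ₉ (thetaInt (delta_root hγ)) = 278 := by rw [residueHom_2069_delta hγ φ₉ _ hφ₉γ]; exact e2069δ
  have hφ₉'δ : φ₉' (thetaInt (delta_root hγ)) = 1930 := by rw [residueHom_2069_delta hγ φ₉' _ hφ₉'γ]; exact e2069δ'
  have hφ₇'δ : φ₇' (thetaInt (delta_root hγ)) = 6 := by rw [residueHom_seven_delta hγ φ₇' _ hφ₇'γ]; exact e7δ'
  set v3a : HeightOneSpectrum (𝓞 K) := ⟨RingHom.ker φ₃a, (ker_zmod_isMaximal φ₃a).isPrime, ker_zmod_ne_bot φ₃a⟩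
  set v3b : HeightOneSpectrum (𝓞 K) := ⟨RingHom.ker φ₃b, (ker_zmod_isMaximal φ₃b).isPrime, ker_zmod_ne_bot φ₃b⟩
  set v3c : HeightOneSpectrum (𝓞 K) := ⟨RingHom.ker φ₃c, (ker_zmod_isMaximal φ₃c).isPrime, ker_zmod_ne_bot φ₃c⟩
  set v7 : HeightOneSpectrum (𝓞 K) := ⟨RingHom.ker φ₇, (ker_zmod_isMaximal φ₇).isPrime, ker_zmod_ne_bot φ₇⟩
  set v7' : HeightOneSpectrum (𝓞 K) := ⟨RingHom.ker φ₇', (ker_zmod_isMaximal φ₇').isPrime, ker_zmod_ne_bot φ₇'⟩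
  set v9 : HeightOneSpectrum (𝓞 K) := ⟨RingHom.ker φ₉, (ker_zmod_isMaximal φ₉).isPrime, ker_zmod_ne_bot φ₉⟩
  set v9' : HeightOneSpectrum (𝓞 K) := ⟨RingHom.ker φ₉', (ker_zmod_isMaximal φ₉').isPrime, ker_zmod_ne_bot φ₉'⟩
  -- the criterion
  refine sha_inf_range_twoIsogenyTorsorHom_eq_bot_of_local' X
    (S := {v | ((-463078 : ℤ) : 𝓞 K) + (158036 : ℤ) * thetaInt (aeval_eq hγ) +
      (-88849 : ℤ) * thetaInt (delta_root hγ) ∈ v.asIdeal}) ?_ ?_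
  · intro v hv
    rw [hX'eq]
    constructor
    · have e : (146 * γ ^ 2 + 310 * γ + 2476 : K) = algebraMap (𝓞 K) K (((-152 : ℤ) : 𝓞 K) +
          (456 : ℤ) * thetaInt (aeval_eq hγ) + (438 : ℤ) * thetaInt (delta_root hγ)) := by
        rw [← RingOfIntegers.coe_eq_algebraMap, coe_lin hγ]; push_cast; ring
      change v.valuation K (146 * γ ^ 2 + 310 * γ + 2476 : K) ≤ 1
      rw [e]; exact HeightOneSpectrum.valuation_le_one v _
    · change v.valuation K ((-88849 * γ ^ 2 + 562957 * γ - 2988516) / 3 : K) = 1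
      rw [← coe_Bpint hγ]; exact (HeightOneSpectrum.valuation_eq_one_iff_notMem v).mpr hv
  intro q hq hsel hfin _hinf
  rw [hX'eq] at hfin ⊢
  -- `q ∈ K(S, 2)`: even valuation outside `supp B'`
  rw [mk_mem_selmerGroup_iff] at hsel
  -- `K(S, 2)` enumeration: `q = ± ε^i π₀^c (sublist product) w²`
  obtain ⟨s, i, c, l, w, hl, hqrep⟩ := exists_rep_of_two_dvd_log_outside hγ h3 ψ₁
    [(v3c, ((2 : ℤ) : 𝓞 K) + (-4 : ℤ) * thetaInt (aeval_eq hγ) + (-1 : ℤ) * thetaInt (delta_root hγ)),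
     (v7, ((-1 : ℤ) : 𝓞 K) + (-1 : ℤ) * thetaInt (aeval_eq hγ) + (0 : ℤ) * thetaInt (delta_root hγ)),
     (v9, ((-234 : ℤ) : 𝓞 K) + (40 : ℤ) * thetaInt (aeval_eq hγ) + (41 : ℤ) * thetaInt (delta_root hγ))]
    (by
      intro p hp
      simp only [List.mem_cons, List.mem_nil_iff, or_false] at hp
      rcases hp with rfl | rfl | rfl
      · exact ⟨ker_ne_ker_of_ne φ₃c ψ₁ (by norm_num), 3, span_witness_p3c hγ h3 ψ₁ hψ₁ φ₃c hφ₃cγ hφ₃cδ⟩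
      · refine ⟨ker_ne_ker_of_ne φ₇ ψ₁ (by norm_num), 0, ?_⟩
        rw [pow_zero, mul_one]; exact span_witness_q7 hγ h3 φ₇ hφ₇γ
      · exact ⟨ker_ne_ker_of_ne φ₉ ψ₁ (by norm_num), 4, span_witness_q2069 hγ h3 ψ₁ hψ₁ φ₉ hφ₉γ hφ₉δ⟩)
    hq
    (by
      intro v hv2 hvL
      by_cases hvS : ((-463078 : ℤ) : 𝓞 K) + (158036 : ℤ) * thetaInt (aeval_eq hγ) +
          (-88849 : ℤ) * thetaInt (delta_root hγ) ∈ v.asIdeal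
      · exfalso
        rcases support_Bp hγ h3 ψ₁ φ₃c hφ₃cδ φ₇ hφ₇γ φ₉ hφ₉γ v hvS with h | h | h | h
        · exact hv2 h
        · exact hvL (v3c, _) List.mem_cons_self (HeightOneSpectrum.ext h)
        · exact hvL (v7, _) (List.mem_cons_of_mem _ List.mem_cons_self) (HeightOneSpectrum.ext h)
        · exact hvL (v9, _) (List.mem_cons_of_mem _ (List.mem_cons_of_mem _ List.mem_cons_self))
            (HeightOneSpectrum.ext h)
      · have := hsel v hvS
        rwa [Units.val_mk0] at this)
  simp only [List.map_cons, List.map_nil] at hl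
  obtain ⟨e₁, e₂, e₃, he₁, he₂, he₃, hlprod⟩ := prod_eq_pow_of_sublist_three _ _ _ hl
  -- the integral representative `d`
  set d : 𝓞 K := (-1) ^ (s : ℕ) * (-15 - thetaInt (aeval_eq hγ) + 2 * thetaInt (delta_root hγ)) ^ (i : ℕ) *
      (((6 : ℤ) : 𝓞 K) + (1 : ℤ) * thetaInt (aeval_eq hγ) + (-1 : ℤ) * thetaInt (delta_root hγ)) ^ (c : ℕ) *
      ((((2 : ℤ) : 𝓞 K) + (-4 : ℤ) * thetaInt (aeval_eq hγ) + (-1 : ℤ) * thetaInt (delta_root hγ)) ^ e₁ *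
       (((-1 : ℤ) : 𝓞 K) + (-1 : ℤ) * thetaInt (aeval_eq hγ) + (0 : ℤ) * thetaInt (delta_root hγ)) ^ e₂ *
       (((-234 : ℤ) : 𝓞 K) + (40 : ℤ) * thetaInt (aeval_eq hγ) + (41 : ℤ) * thetaInt (delta_root hγ)) ^ e₃) with hd
  have hqd : q = algebraMap (𝓞 K) K d * w ^ 2 := by
    rw [hqrep, hlprod, hd]; simp only [map_mul, map_pow, map_neg, map_one]
  have hs1 : (s : ℕ) ≤ 1 := by omega
  have hi1 : (i : ℕ) ≤ 1 := by omega
  have hc1 : (c : ℕ) ≤ 1 := by omega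
  obtain ⟨nz3a, nz3b, nz7, nz9⟩ := gen_products_ne_zero s i c ⟨e₁, by omega⟩ ⟨e₂, by omega⟩ ⟨e₃, by omega⟩
  replace nz3a : (-1 : ZMod 3) ^ (s : ℕ) * 2 ^ (i : ℕ) * 1 ^ (c : ℕ) * (1 ^ e₁ * 1 ^ e₂ * 1 ^ e₃) ≠ 0 := nz3a
  replace nz3b : (-1 : ZMod 3) ^ (s : ℕ) * 2 ^ (i : ℕ) * 2 ^ (c : ℕ) * (1 ^ e₁ * 2 ^ e₂ * 2 ^ e₃) ≠ 0 := nz3b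
  replace nz7 : (-1 : ZMod 7) ^ (s : ℕ) * 3 ^ (i : ℕ) * 1 ^ (c : ℕ) * (6 ^ e₁ * 5 ^ e₂ * 3 ^ e₃) ≠ 0 := nz7
  replace nz9 : (-1 : ZMod 2069) ^ (s : ℕ) * 498 ^ (i : ℕ) * 1423 ^ (c : ℕ) * (1236 ^ e₁ * 790 ^ e₂ * 1738 ^ e₃) ≠ 0 :=
    nz9
  -- residues of `d`
  have hd3a : φ₃a d = (-1 : ZMod 3) ^ (s : ℕ) * 2 ^ (i : ℕ) * 1 ^ (c : ℕ) * (1 ^ e₁ * 1 ^ e₂ * 1 ^ e₃) := by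
    rw [hd]; simp only [map_mul, map_pow, map_neg, map_one, map_add, map_sub, map_ofNat, map_intCast, hφ₃aγ, hφ₃aδ,
      eE3a, eP3a, eG3a, eQ3a, eR3a]
  have hd3b : φ₃b d = (-1 : ZMod 3) ^ (s : ℕ) * 2 ^ (i : ℕ) * 2 ^ (c : ℕ) * (1 ^ e₁ * 2 ^ e₂ * 2 ^ e₃) := by
    rw [hd]; simp only [map_mul, map_pow, map_neg, map_one, map_add, map_sub, map_ofNat, map_intCast, hφ₃bγ, hφ₃bδ,
      eE3b, eP3b, eG3b, eQ3b, eR3b]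
  have hd7 : φ₇' d = (-1 : ZMod 7) ^ (s : ℕ) * 3 ^ (i : ℕ) * 1 ^ (c : ℕ) * (6 ^ e₁ * 5 ^ e₂ * 3 ^ e₃) := by
    rw [hd]; simp only [map_mul, map_pow, map_neg, map_one, map_add, map_sub, map_ofNat, map_intCast, hφ₇'γ, hφ₇'δ,
      eE7, eP7, eG7, eQ7, eR7]
  have hd9 : φ₉' d = (-1 : ZMod 2069) ^ (s : ℕ) * 498 ^ (i : ℕ) * 1423 ^ (c : ℕ) * (1236 ^ e₁ * 790 ^ e₂ * 1738 ^ e₃) := by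
    rw [hd]; simp only [map_mul, map_pow, map_neg, map_one, map_add, map_sub, map_ofNat, map_intCast, hφ₉'γ, hφ₉'δ,
      eE9, eP9, eG9, eQ9, eR9]
  -- local conditions for `d` at the four kill places
  have hlocd : ∀ v : HeightOneSpectrum (𝓞 K), sqClass (algebraMap K (v.adicCompletion K) (algebraMap (𝓞 K) K d)) ∈
      Set.range ((⟨0, 146 * γ ^ 2 + 310 * γ + 2476, 0, (-88849 * γ ^ 2 + 562957 * γ - 2988516) / 3, 0⟩ :
        WeierstrassCurve K).baseChange (v.adicCompletion K)).xSqClass := by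
    intro v; rw [← sqClass_map_mul_sq _ hq hqd]; exact hfin v
  obtain ⟨r3a, hr3a, h3a⟩ := sq_residue_p3a hγ φ₃a hφ₃aγ hφ₃aδ v3a rfl (by rw [hd3a]; exact nz3a) (hlocd _)
  obtain ⟨r3b, hr3b, h3b⟩ := sq_residue_p3b hγ φ₃b hφ₃bγ hφ₃bδ v3b rfl (by rw [hd3b]; exact nz3b) (hlocd _)
  obtain ⟨r7, hr7, h7⟩ := sq_residue_p7 hγ φ₇' hφ₇'γ v7' rfl (by rw [hd7]; exact nz7) (hlocd _)
  obtain ⟨r9, hr9, h9⟩ := sq_residue_p2069 hγ h3 φ₉' hφ₉'γ v9' rfl (by rw [hd9]; exact nz9) (hlocd _)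
  rw [hd3a] at h3a; rw [hd3b] at h3b; rw [hd7] at h7; rw [hd9] at h9
  -- `𝔭₂₀₆₉` forces `e₁ = 0`
  have he₁0 : e₁ = 0 := by
    rcases Nat.le_one_iff_eq_zero_or_eq_one.mp he₁ with h | h
    · exact h
    · exfalso
      subst h
      apply nsq
      rw [sq1, sq2, sq3, sq5, sq6, pow_one] at h9
      have hw : ((164 : ZMod 2069) ^ 2) ^ (s : ℕ) * (415 ^ 2) ^ (i : ℕ) * (518 ^ 2) ^ (c : ℕ) *
          ((666 : ZMod 2069) ^ 2) ^ e₂ * (414 ^ 2) ^ e₃ ≠ 0 := by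
        rw [← sq1, ← sq2, ← sq3, ← sq5, ← sq6]
        intro h0; apply nz9; rw [pow_one]
        linear_combination (1236 : ZMod 2069) * h0
      set u : ZMod 2069 := 164 ^ (s : ℕ) * 415 ^ (i : ℕ) * 518 ^ (c : ℕ) * 666 ^ e₂ * 414 ^ e₃ with hu
      have hu2 : ((164 : ZMod 2069) ^ 2) ^ (s : ℕ) * (415 ^ 2) ^ (i : ℕ) * (518 ^ 2) ^ (c : ℕ) *
          ((666 : ZMod 2069) ^ 2) ^ e₂ * (414 ^ 2) ^ e₃ = u ^ 2 := by
        rw [hu, mul_pow, mul_pow, mul_pow, mul_pow, pow_right_comm (164 : ZMod 2069) (s : ℕ) 2,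
          pow_right_comm (415 : ZMod 2069) (i : ℕ) 2, pow_right_comm (518 : ZMod 2069) (c : ℕ) 2,
          pow_right_comm (666 : ZMod 2069) e₂ 2, pow_right_comm (414 : ZMod 2069) e₃ 2]
      have hu0 : u ≠ 0 := by intro h0; apply hw; rw [hu2, h0]; ring
      have h9' : (1236 : ZMod 2069) * u ^ 2 = r9 ^ 2 := by rw [← hu2]; linear_combination h9
      refine ⟨r9 / u, ?_⟩
      field_simp
      linear_combination h9'
  obtain ⟨hc0, hsi, he23⟩ := kill_phi_side s i c ⟨e₁, by omega⟩ ⟨e₂, by omega⟩ ⟨e₃, by omega⟩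
    ⟨r3a, hr3a, h3a⟩ ⟨r3b, hr3b, h3b⟩ ⟨r7, hr7, h7⟩ he₁0
  replace he23 : e₂ = e₃ := he23
  -- the survivors are in `α(X'(K))`
  have hcl : sqClass q = sqClass (algebraMap (𝓞 K) K d) := by
    simpa only [RingHom.id_apply] using sqClass_map_mul_sq (RingHom.id K) hq hqd
  have hy : algebraMap (𝓞 K) K ((((-1 : ℤ) : 𝓞 K) + (-1 : ℤ) * thetaInt (aeval_eq hγ) +
      (0 : ℤ) * thetaInt (delta_root hγ)) * (((-234 : ℤ) : 𝓞 K) + (40 : ℤ) * thetaInt (aeval_eq hγ) +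
      (41 : ℤ) * thetaInt (delta_root hγ))) = ((-161 * γ ^ 2 + 992 * γ + 1440) / 3 : K) := by
    rw [map_mul, ← RingOfIntegers.coe_eq_algebraMap, ← RingOfIntegers.coe_eq_algebraMap, coe_lin hγ, coe_lin hγ]
    push_cast
    linear_combination (-(41 : K) / 3) * hγ
  have hε : algebraMap (𝓞 K) K (-15 - thetaInt (aeval_eq hγ) + 2 * thetaInt (delta_root hγ)) =
      ((2 * γ ^ 2 - 5 * γ - 9) / 3 : K) := by
    rw [show (-15 - thetaInt (aeval_eq hγ) + 2 * thetaInt (delta_root hγ) : 𝓞 K) =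
        ((-15 : ℤ) : 𝓞 K) + (-1 : ℤ) * thetaInt (aeval_eq hγ) + (2 : ℤ) * thetaInt (delta_root hγ) by push_cast; ring,
      ← RingOfIntegers.coe_eq_algebraMap, coe_lin hγ]
    push_cast; ring
  rw [hcl, hd, hc0, ← hsi]
  subst he₁0; subst he23
  rcases Nat.le_one_iff_eq_zero_or_eq_one.mp hs1 with hs0 | hs0 <;>
    rcases Nat.le_one_iff_eq_zero_or_eq_one.mp he₂ with he0 | he0 <;>
    rw [hs0, he0] <;> simp only [pow_zero, pow_one, mul_one, one_mul]
  · rw [map_one]; exact ⟨0, by rw [xSqClass_zero]; exact ((sqClass_eq_one_iff one_ne_zero).mpr ⟨1, by ring⟩).symm⟩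
  · rw [hy]; exact sqClass_y_mem hγ
  · rw [map_mul, map_neg, map_one, hε, neg_one_mul]; exact sqClass_neg_eps_mem hγ
  · rw [map_mul, map_mul, map_neg, map_one, hε, hy, neg_one_mul]
    rw [sqClass_mul (neg_ne_zero.mpr (eps_ne_zero hγ)) (y_ne_zero hγ)]
    exact mul_mem_range_xSqClass (sqClass_neg_eps_mem hγ) (sqClass_y_mem hγ)

end KubertTate289Cubic

end Literature.NumberTheory.EllipticCurves

end
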